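import Summits.RiemannHypothesis.RiemannHypothesis.Theorems.Splittings.RobinFiniteCakeRowsB

/-!
# RobinFiniteCakeLaw — gen 19 «LAYER CAKE AT PT», part 6/10 (E): `def cakeCost`, the zero-side bound `offLine_le_cake : OFF(T,x) ≤ cakeCost T X` (`1 ≤ x ≤ X`, `T ≥ 3·10¹²`) and THE CAKE LAW `robinCA_below_of_cake`: the three θ-facts + `hCS` + `hF5` + RH to height `T ≥ H₀` + ONE numerical inequality `(1 + 2/log(2·10²²))·cakeCost T X + 2.07·10⁻¹⁶·√X ≤ 0.4857` ⟹ `robinCA_below (X+1)` (consumer: the tree's `robinCA_below_of_offLineR`, gen 13).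

Cell rh-split, seat rh-split-robin-finite g19 (card `cards/SPLIT-robin-finite.md` §26); carved VERBATIM from
`HOME/rh-split-robin-finite/g19/SketchG19.lean` (sha16 c333eb23d46ea866) by `mk_carve.py`.  Nothing here bears on the truth of RH.

HONEST LABEL: SPLITTING SEARCH over kernel-typed RH-EQUIVALENCES; a splitting A ∧ B ⟹ RH is CONDITIONAL
bookkeeping unless A and B are both proved; nothing here bears on the truth of RH.
-/

set_option linter.dupNamespace false

noncomputable section

open Real Filter Finset
open scoped Chebyshev ComplexConjugate

namespace Summit.RiemannHypothesis.RiemannHypothesis.Theorems.Splittings.RobinFiniteC1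

open Literature.NumberTheory.LFunctions Literature.NumberTheory.DiophantineGeometry
open Literature.NumberTheory.LFunctions.SchoenfeldBound
open Literature.NumberTheory.LFunctions.NicolasJExplicit
open RobinAnalyticSharp
open Literature.NumberTheory.LFunctions.VdC.Num (rpow_le_of_pow_le le_rpow_of_pow_le)
open Summit.RiemannHypothesis.RiemannHypothesis.Theorems.Splittings.RobinFiniteE3
open Summit.RiemannHypothesis.RiemannHypothesis.Theorems.Splittings.RobinFiniteTail
  (zeroTailBound_tailH tailH_PT_le tailH_nonneg)
open Summit.RiemannHypothesis.RiemannHypothesis.Theorems.Splittings.RobinFiniteE1c (summable_tailTerm)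

section CakeLaw

/-! ### C7 · THE LAYER CAKE: cost functional, the off-line bound on `[1, X]`, and the RANGE-FREE cake law -/

/-- **The cake cost** `cakeCost T X = (X^{3/10}+1)/2·tailH(T) + Σ_{k=1}^{14} (X^{u_{k+1}} − X^{u_k})/2·M̄_k(T)`, cuts
`u_k = σ_k − ½ ∈ {3 / 10, 13 / 40, 7 / 20, 3 / 8, 2 / 5, 41 / 100, 21 / 50, 43 / 100, 11 / 25, 9 / 20, 23 / 50, 47 / 100, 12 / 25, 49 / 100}`, `u_{15} = ½`; `M̄_k(T) = 4·A_k·4^{a_k}·T^{a_k−2}/(1 − 4^{a_k−2})`.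
An explicit elementary function of `(T, X)` (no zeros of `ζ` in it). -/
def cakeCost (T X : ℝ) : ℝ :=
  (X ^ (3 / 10 : ℝ) + 1) / 2 * ((Real.log (T / (2 * π)) + 1) / (π * T) + (184 + 30 * Real.log T) / T ^ 2)
    + (X ^ (13 / 40 : ℝ) - X ^ (3 / 10 : ℝ)) / 2 * (2 * (2 * (8922.2 * (4 : ℝ) ^ (7 / 12 : ℝ) * T ^ ((7 / 12 : ℝ) - 2) / (1 - (4 : ℝ) ^ ((7 / 12 : ℝ) - 2)))))
    + (X ^ (7 / 20 : ℝ) - X ^ (13 / 40 : ℝ)) / 2 * (2 * (2 * (6837.2 * (4 : ℝ) ^ (8 / 15 : ℝ) * T ^ ((8 / 15 : ℝ) - 2) / (1 - (4 : ℝ) ^ ((8 / 15 : ℝ) - 2)))))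
    + (X ^ (3 / 8 : ℝ) - X ^ (7 / 20 : ℝ)) / 2 * (2 * (2 * (7906.9 * (4 : ℝ) ^ (7 / 15 : ℝ) * T ^ ((7 / 15 : ℝ) - 2) / (1 - (4 : ℝ) ^ ((7 / 15 : ℝ) - 2)))))
    + (X ^ (2 / 5 : ℝ) - X ^ (3 / 8 : ℝ)) / 2 * (2 * (2 * (5192.2 * (4 : ℝ) ^ (5 / 12 : ℝ) * T ^ ((5 / 12 : ℝ) - 2) / (1 - (4 : ℝ) ^ ((5 / 12 : ℝ) - 2)))))
    + (X ^ (41 / 100 : ℝ) - X ^ (2 / 5 : ℝ)) / 2 * (2 * (2 * (24906 * (4 : ℝ) ^ (3 / 8 : ℝ) * T ^ ((3 / 8 : ℝ) - 2) / (1 - (4 : ℝ) ^ ((3 / 8 : ℝ) - 2)))))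
    + (X ^ (21 / 50 : ℝ) - X ^ (41 / 100 : ℝ)) / 2 * (2 * (2 * (18887 * (4 : ℝ) ^ (5 / 14 : ℝ) * T ^ ((5 / 14 : ℝ) - 2) / (1 - (4 : ℝ) ^ ((5 / 14 : ℝ) - 2)))))
    + (X ^ (43 / 100 : ℝ) - X ^ (21 / 50 : ℝ)) / 2 * (2 * (2 * (36427 * (4 : ℝ) ^ (4 / 13 : ℝ) * T ^ ((4 / 13 : ℝ) - 2) / (1 - (4 : ℝ) ^ ((4 / 13 : ℝ) - 2)))))
    + (X ^ (11 / 25 : ℝ) - X ^ (43 / 100 : ℝ)) / 2 * (2 * (2 * (30387 * (4 : ℝ) ^ (2 / 7 : ℝ) * T ^ ((2 / 7 : ℝ) - 2) / (1 - (4 : ℝ) ^ ((2 / 7 : ℝ) - 2)))))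
    + (X ^ (9 / 20 : ℝ) - X ^ (11 / 25 : ℝ)) / 2 * (2 * (2 * (23407 * (4 : ℝ) ^ (4 / 15 : ℝ) * T ^ ((4 / 15 : ℝ) - 2) / (1 - (4 : ℝ) ^ ((4 / 15 : ℝ) - 2)))))
    + (X ^ (23 / 50 : ℝ) - X ^ (9 / 20 : ℝ)) / 2 * (2 * (2 * (30039 * (4 : ℝ) ^ (3 / 13 : ℝ) * T ^ ((3 / 13 : ℝ) - 2) / (1 - (4 : ℝ) ^ ((3 / 13 : ℝ) - 2)))))
    + (X ^ (47 / 100 : ℝ) - X ^ (23 / 50 : ℝ)) / 2 * (2 * (2 * (21401 * (4 : ℝ) ^ (3 / 14 : ℝ) * T ^ ((3 / 14 : ℝ) - 2) / (1 - (4 : ℝ) ^ ((3 / 14 : ℝ) - 2)))))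
    + (X ^ (12 / 25 : ℝ) - X ^ (47 / 100 : ℝ)) / 2 * (2 * (2 * (24602 * (4 : ℝ) ^ (2 / 11 : ℝ) * T ^ ((2 / 11 : ℝ) - 2) / (1 - (4 : ℝ) ^ ((2 / 11 : ℝ) - 2)))))
    + (X ^ (49 / 100 : ℝ) - X ^ (12 / 25 : ℝ)) / 2 * (2 * (2 * (24770 * (4 : ℝ) ^ (2 / 13 : ℝ) * T ^ ((2 / 13 : ℝ) - 2) / (1 - (4 : ℝ) ^ ((2 / 13 : ℝ) - 2)))))
    + (X ^ (1 / 2 : ℝ) - X ^ (49 / 100 : ℝ)) / 2 * (2 * (2 * (25594 * (4 : ℝ) ^ (1 / 8 : ℝ) * T ^ ((1 / 8 : ℝ) - 2) / (1 - (4 : ℝ) ^ ((1 / 8 : ℝ) - 2)))))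

/-- **THE LAYER CAKE (RH-free).**  Modulo the two printed density inputs in hypothesis position (`hCS`: the Literature fact
`ChourasiyaSimonic2025_cor1`, PREPRINT; `hF5`: the Literature fact FKS 2023 Table 5): for `T ≥ 3·10¹²` and `1 ≤ x ≤ X`,
`Σ_{|γ|>T} m·x^{β−½}/γ² ≤ cakeCost T X`.  Mechanism: pair `ρ ↔ 1−ρ̄` (`offLine_eq_tsum_symm`), charge `ch_x(β−½) =
(x^{|β−½|}+x^{−|β−½|})/2 ≤ (X^{u₁}+1)/2 + Σ_k [u_k ≤ |β−½|]·(X^{u_{k+1}}−X^{u_k})/2` (telescoped staircase under the convex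
charge), and bound each class mass `Σ_{|γ|>T, |β−½|≥u_k} m/γ² ≤ M̄_k(T)` by layer `k`'s density row.  The law of record's two layers
`{β<0.9 | β≥0.9}` are the case of ONE cut. -/
theorem offLine_le_cake (hCS : ChourasiyaSimonic2025_cor1)
    (hF5 : FioriKadiriSwidinsky2023_table5) {T : ℝ} (hT : 3 * (10 : ℝ) ^ 12 ≤ T) {x X : ℝ} (hx : 1 ≤ x) (hxX : x ≤ X) :
    ∑' ρ : RHWave0.riemannZetaNontrivialZeros,
        (if T < |(ρ : ℂ).im| then
          (riemannZetaZeroOrder (ρ : ℂ) : ℝ) * x ^ ((ρ : ℂ).re - 1 / 2) / (ρ : ℂ).im ^ 2 else 0) ≤ cakeCost T X := by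
  have hT7 : (7 : ℝ) ≤ T := le_trans (by norm_num) hT
  have hT0 : 0 < T := by linarith
  have h0 := offLine_le_start_window (T := T) (x := x) (X := X) (u₁ := 3 / 10) hT7 hx hxX (by norm_num)
  have p1 := cakePhi_peel_window (T := T) (x := x) (X := X) (u := 3 / 10) (v := 13 / 40) hx hxX (by norm_num) (by norm_num)
    (cakeMass_layer1 hCS hT) (massExpr_nonneg (by norm_num) (by norm_num) hT0)
  have p2 := cakePhi_peel_window (T := T) (x := x) (X := X) (u := 13 / 40) (v := 7 / 20) hx hxX (by norm_num) (by norm_num)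
    (cakeMass_layer2 hCS hT) (massExpr_nonneg (by norm_num) (by norm_num) hT0)
  have p3 := cakePhi_peel_window (T := T) (x := x) (X := X) (u := 7 / 20) (v := 3 / 8) hx hxX (by norm_num) (by norm_num)
    (cakeMass_layer3 hCS hT) (massExpr_nonneg (by norm_num) (by norm_num) hT0)
  have p4 := cakePhi_peel_window (T := T) (x := x) (X := X) (u := 3 / 8) (v := 2 / 5) hx hxX (by norm_num) (by norm_num)
    (cakeMass_layer4 hCS hT) (massExpr_nonneg (by norm_num) (by norm_num) hT0)
  have p5 := cakePhi_peel_window (T := T) (x := x) (X := X) (u := 2 / 5) (v := 41 / 100) hx hxX (by norm_num) (by norm_num)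
    (cakeMass_layer5 hF5 hT) (massExpr_nonneg (by norm_num) (by norm_num) hT0)
  have p6 := cakePhi_peel_window (T := T) (x := x) (X := X) (u := 41 / 100) (v := 21 / 50) hx hxX (by norm_num) (by norm_num)
    (cakeMass_layer6 hF5 hT) (massExpr_nonneg (by norm_num) (by norm_num) hT0)
  have p7 := cakePhi_peel_window (T := T) (x := x) (X := X) (u := 21 / 50) (v := 43 / 100) hx hxX (by norm_num) (by norm_num)
    (cakeMass_layer7 hF5 hT) (massExpr_nonneg (by norm_num) (by norm_num) hT0)
  have p8 := cakePhi_peel_window (T := T) (x := x) (X := X) (u := 43 / 100) (v := 11 / 25) hx hxX (by norm_num) (by norm_num)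
    (cakeMass_layer8 hF5 hT) (massExpr_nonneg (by norm_num) (by norm_num) hT0)
  have p9 := cakePhi_peel_window (T := T) (x := x) (X := X) (u := 11 / 25) (v := 9 / 20) hx hxX (by norm_num) (by norm_num)
    (cakeMass_layer9 hF5 hT) (massExpr_nonneg (by norm_num) (by norm_num) hT0)
  have p10 := cakePhi_peel_window (T := T) (x := x) (X := X) (u := 9 / 20) (v := 23 / 50) hx hxX (by norm_num) (by norm_num)
    (cakeMass_layer10 hF5 hT) (massExpr_nonneg (by norm_num) (by norm_num) hT0)
  have p11 := cakePhi_peel_window (T := T) (x := x) (X := X) (u := 23 / 50) (v := 47 / 100) hx hxX (by norm_num) (by norm_num)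
    (cakeMass_layer11 hF5 hT) (massExpr_nonneg (by norm_num) (by norm_num) hT0)
  have p12 := cakePhi_peel_window (T := T) (x := x) (X := X) (u := 47 / 100) (v := 12 / 25) hx hxX (by norm_num) (by norm_num)
    (cakeMass_layer12 hF5 hT) (massExpr_nonneg (by norm_num) (by norm_num) hT0)
  have p13 := cakePhi_peel_window (T := T) (x := x) (X := X) (u := 12 / 25) (v := 49 / 100) hx hxX (by norm_num) (by norm_num)
    (cakeMass_layer13 hF5 hT) (massExpr_nonneg (by norm_num) (by norm_num) hT0)
  have p14 := cakePhi_peel_window (T := T) (x := x) (X := X) (u := 49 / 100) (v := 1 / 2) hx hxX (by norm_num) (by norm_num)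
    (cakeMass_layer14 hF5 hT) (massExpr_nonneg (by norm_num) (by norm_num) hT0)
  have hend := cakePhi_half T x
  unfold cakeCost
  linarith

/-- `(X : ℕ)`-powers are monotone in the exponent on `(0, ∞)` (also at `X = 0`). -/
theorem natCast_rpow_mono {X : ℕ} {u v : ℝ} (hu : 0 < u) (huv : u ≤ v) : (X : ℝ) ^ u ≤ (X : ℝ) ^ v := by
  rcases Nat.eq_zero_or_pos X with h0 | hpos
  · subst h0
    rw [Nat.cast_zero, Real.zero_rpow hu.ne', Real.zero_rpow (by linarith : v ≠ 0)]
  · exact Real.rpow_le_rpow_of_exponent_le (by exact_mod_cast hpos) huv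

set_option maxHeartbeats 400000 in
/-- The cake cost is non-negative at natural `X` and `T > 0` with `tailH(T) ≥ 0` (`T ≥ 7`). -/
theorem cakeCost_natCast_nonneg {T : ℝ} (hT : 7 ≤ T) (X : ℕ) : 0 ≤ cakeCost T (X : ℝ) := by
  have hT0 : 0 < T := by linarith
  have htH := tailH_nonneg hT
  have b0 : 0 ≤ (((X : ℝ)) ^ (3 / 10 : ℝ) + 1) / 2 * ((Real.log (T / (2 * π)) + 1) / (π * T) + (184 + 30 * Real.log T) / T ^ 2) :=
    mul_nonneg (by positivity) htH
  have d1 : 0 ≤ (((X : ℝ)) ^ (13 / 40 : ℝ) - ((X : ℝ)) ^ (3 / 10 : ℝ)) / 2 * (2 * (2 * (8922.2 * (4 : ℝ) ^ (7 / 12 : ℝ) * T ^ ((7 / 12 : ℝ) - 2) / (1 - (4 : ℝ) ^ ((7 / 12 : ℝ) - 2))))) :=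
    mul_nonneg (by linarith [natCast_rpow_mono (X := X) (u := 3 / 10) (v := 13 / 40) (by norm_num) (by norm_num)])
      (massExpr_nonneg (by norm_num) (by norm_num) hT0)
  have d2 : 0 ≤ (((X : ℝ)) ^ (7 / 20 : ℝ) - ((X : ℝ)) ^ (13 / 40 : ℝ)) / 2 * (2 * (2 * (6837.2 * (4 : ℝ) ^ (8 / 15 : ℝ) * T ^ ((8 / 15 : ℝ) - 2) / (1 - (4 : ℝ) ^ ((8 / 15 : ℝ) - 2))))) :=
    mul_nonneg (by linarith [natCast_rpow_mono (X := X) (u := 13 / 40) (v := 7 / 20) (by norm_num) (by norm_num)])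
      (massExpr_nonneg (by norm_num) (by norm_num) hT0)
  have d3 : 0 ≤ (((X : ℝ)) ^ (3 / 8 : ℝ) - ((X : ℝ)) ^ (7 / 20 : ℝ)) / 2 * (2 * (2 * (7906.9 * (4 : ℝ) ^ (7 / 15 : ℝ) * T ^ ((7 / 15 : ℝ) - 2) / (1 - (4 : ℝ) ^ ((7 / 15 : ℝ) - 2))))) :=
    mul_nonneg (by linarith [natCast_rpow_mono (X := X) (u := 7 / 20) (v := 3 / 8) (by norm_num) (by norm_num)])
      (massExpr_nonneg (by norm_num) (by norm_num) hT0)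
  have d4 : 0 ≤ (((X : ℝ)) ^ (2 / 5 : ℝ) - ((X : ℝ)) ^ (3 / 8 : ℝ)) / 2 * (2 * (2 * (5192.2 * (4 : ℝ) ^ (5 / 12 : ℝ) * T ^ ((5 / 12 : ℝ) - 2) / (1 - (4 : ℝ) ^ ((5 / 12 : ℝ) - 2))))) :=
    mul_nonneg (by linarith [natCast_rpow_mono (X := X) (u := 3 / 8) (v := 2 / 5) (by norm_num) (by norm_num)])
      (massExpr_nonneg (by norm_num) (by norm_num) hT0)
  have d5 : 0 ≤ (((X : ℝ)) ^ (41 / 100 : ℝ) - ((X : ℝ)) ^ (2 / 5 : ℝ)) / 2 * (2 * (2 * (24906 * (4 : ℝ) ^ (3 / 8 : ℝ) * T ^ ((3 / 8 : ℝ) - 2) / (1 - (4 : ℝ) ^ ((3 / 8 : ℝ) - 2))))) :=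
    mul_nonneg (by linarith [natCast_rpow_mono (X := X) (u := 2 / 5) (v := 41 / 100) (by norm_num) (by norm_num)])
      (massExpr_nonneg (by norm_num) (by norm_num) hT0)
  have d6 : 0 ≤ (((X : ℝ)) ^ (21 / 50 : ℝ) - ((X : ℝ)) ^ (41 / 100 : ℝ)) / 2 * (2 * (2 * (18887 * (4 : ℝ) ^ (5 / 14 : ℝ) * T ^ ((5 / 14 : ℝ) - 2) / (1 - (4 : ℝ) ^ ((5 / 14 : ℝ) - 2))))) :=
    mul_nonneg (by linarith [natCast_rpow_mono (X := X) (u := 41 / 100) (v := 21 / 50) (by norm_num) (by norm_num)])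
      (massExpr_nonneg (by norm_num) (by norm_num) hT0)
  have d7 : 0 ≤ (((X : ℝ)) ^ (43 / 100 : ℝ) - ((X : ℝ)) ^ (21 / 50 : ℝ)) / 2 * (2 * (2 * (36427 * (4 : ℝ) ^ (4 / 13 : ℝ) * T ^ ((4 / 13 : ℝ) - 2) / (1 - (4 : ℝ) ^ ((4 / 13 : ℝ) - 2))))) :=
    mul_nonneg (by linarith [natCast_rpow_mono (X := X) (u := 21 / 50) (v := 43 / 100) (by norm_num) (by norm_num)])
      (massExpr_nonneg (by norm_num) (by norm_num) hT0)
  have d8 : 0 ≤ (((X : ℝ)) ^ (11 / 25 : ℝ) - ((X : ℝ)) ^ (43 / 100 : ℝ)) / 2 * (2 * (2 * (30387 * (4 : ℝ) ^ (2 / 7 : ℝ) * T ^ ((2 / 7 : ℝ) - 2) / (1 - (4 : ℝ) ^ ((2 / 7 : ℝ) - 2))))) :=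
    mul_nonneg (by linarith [natCast_rpow_mono (X := X) (u := 43 / 100) (v := 11 / 25) (by norm_num) (by norm_num)])
      (massExpr_nonneg (by norm_num) (by norm_num) hT0)
  have d9 : 0 ≤ (((X : ℝ)) ^ (9 / 20 : ℝ) - ((X : ℝ)) ^ (11 / 25 : ℝ)) / 2 * (2 * (2 * (23407 * (4 : ℝ) ^ (4 / 15 : ℝ) * T ^ ((4 / 15 : ℝ) - 2) / (1 - (4 : ℝ) ^ ((4 / 15 : ℝ) - 2))))) :=
    mul_nonneg (by linarith [natCast_rpow_mono (X := X) (u := 11 / 25) (v := 9 / 20) (by norm_num) (by norm_num)])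
      (massExpr_nonneg (by norm_num) (by norm_num) hT0)
  have d10 : 0 ≤ (((X : ℝ)) ^ (23 / 50 : ℝ) - ((X : ℝ)) ^ (9 / 20 : ℝ)) / 2 * (2 * (2 * (30039 * (4 : ℝ) ^ (3 / 13 : ℝ) * T ^ ((3 / 13 : ℝ) - 2) / (1 - (4 : ℝ) ^ ((3 / 13 : ℝ) - 2))))) :=
    mul_nonneg (by linarith [natCast_rpow_mono (X := X) (u := 9 / 20) (v := 23 / 50) (by norm_num) (by norm_num)])
      (massExpr_nonneg (by norm_num) (by norm_num) hT0)
  have d11 : 0 ≤ (((X : ℝ)) ^ (47 / 100 : ℝ) - ((X : ℝ)) ^ (23 / 50 : ℝ)) / 2 * (2 * (2 * (21401 * (4 : ℝ) ^ (3 / 14 : ℝ) * T ^ ((3 / 14 : ℝ) - 2) / (1 - (4 : ℝ) ^ ((3 / 14 : ℝ) - 2))))) :=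
    mul_nonneg (by linarith [natCast_rpow_mono (X := X) (u := 23 / 50) (v := 47 / 100) (by norm_num) (by norm_num)])
      (massExpr_nonneg (by norm_num) (by norm_num) hT0)
  have d12 : 0 ≤ (((X : ℝ)) ^ (12 / 25 : ℝ) - ((X : ℝ)) ^ (47 / 100 : ℝ)) / 2 * (2 * (2 * (24602 * (4 : ℝ) ^ (2 / 11 : ℝ) * T ^ ((2 / 11 : ℝ) - 2) / (1 - (4 : ℝ) ^ ((2 / 11 : ℝ) - 2))))) :=
    mul_nonneg (by linarith [natCast_rpow_mono (X := X) (u := 47 / 100) (v := 12 / 25) (by norm_num) (by norm_num)])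
      (massExpr_nonneg (by norm_num) (by norm_num) hT0)
  have d13 : 0 ≤ (((X : ℝ)) ^ (49 / 100 : ℝ) - ((X : ℝ)) ^ (12 / 25 : ℝ)) / 2 * (2 * (2 * (24770 * (4 : ℝ) ^ (2 / 13 : ℝ) * T ^ ((2 / 13 : ℝ) - 2) / (1 - (4 : ℝ) ^ ((2 / 13 : ℝ) - 2))))) :=
    mul_nonneg (by linarith [natCast_rpow_mono (X := X) (u := 12 / 25) (v := 49 / 100) (by norm_num) (by norm_num)])
      (massExpr_nonneg (by norm_num) (by norm_num) hT0)
  have d14 : 0 ≤ (((X : ℝ)) ^ (1 / 2 : ℝ) - ((X : ℝ)) ^ (49 / 100 : ℝ)) / 2 * (2 * (2 * (25594 * (4 : ℝ) ^ (1 / 8 : ℝ) * T ^ ((1 / 8 : ℝ) - 2) / (1 - (4 : ℝ) ^ ((1 / 8 : ℝ) - 2))))) :=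
    mul_nonneg (by linarith [natCast_rpow_mono (X := X) (u := 49 / 100) (v := 1 / 2) (by norm_num) (by norm_num)])
      (massExpr_nonneg (by norm_num) (by norm_num) hT0)
  unfold cakeCost
  linarith

/-- **THE RANGE-FREE CAKE LAW** (gen 14's `robinCA_below_of_densityRefl` with its two-layer zero side replaced by the
14-layer cake): the three RH-free `θ`-facts in print, the two printed density inputs (hypothesis position) and RH verified to ANY
height `T ≥ H₀` give Robin's inequality at every colossally abundant `N > 5040` all of whose primes are `≤ X`, for every natural `X`
with `(1 + 2/log(2·10²²))·cakeCost(T, X) + 2.07·10⁻¹⁶·√X ≤ 0.4857`.  Nothing here bears on the truth of RH. -/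
theorem robinCA_below_of_cake (h16 : Buthe2016_thm2) (hB : Buthe2018_thm2_theta) (hK : BroadbentEtAl2021_theta_rel_1e19)
    (hCS : ChourasiyaSimonic2025_cor1)
    (hF5 : FioriKadiriSwidinsky2023_table5) {T : ℝ} (hT : 3000175332800 ≤ T) (hRH : RiemannHypothesisUpTo T) {X : ℕ}
    (hκ : (1 + 2 / Real.log (2 * (10 : ℝ) ^ 22)) * cakeCost T (X : ℝ) + 2.07e-16 * √(X : ℝ) ≤ 0.4857) :
    robinCA_below (X + 1) := by
  have hT12 : 3 * (10 : ℝ) ^ 12 ≤ T := le_trans (by norm_num) hT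
  have hT7 : (7 : ℝ) ≤ T := le_trans (by norm_num) hT
  exact robinCA_below_of_offLineR h16 hB hK hT hRH
    (fun x hx hxX => offLine_le_cake hCS hF5 hT12 (le_trans (by norm_num) hx) hxX) (cakeCost_natCast_nonneg hT7 X) hκ

end CakeLaw

end Summit.RiemannHypothesis.RiemannHypothesis.Theorems.Splittings.RobinFiniteC1

end
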